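import Summits.CriticalPhenomena.PercolationContinuityZ3.Theorems.PercNearOneGluingNoHeavyLowerTailFrontierDecRowsRow44CutVertex
import HarnessLib

/-!
# Cut-vertex set-up lemmas for the frontier-row cut files (route `PercNearOneGluingNoHeavy`, supports-only; prim-l12-p6 g16)

Every "row R across a cut vertex" file of this lineage (`…Row44CutVertex`, `…Row44ThreeOneCut`, `…Row15ThreeOneCutA`, `…Row36ThreeOneCutA/C`, …)
starts with the same sixty lines: from a colouring `side : Fin n → Bool` and a vertex `h` such that every positive-weight edge avoiding `h`
is monochromatic, the edge sets `F₁` (edges inside the `true` side or at `h`) and `F₂` (edges inside the `false` side or at `h`, not the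
loop at `h`) are disjoint, carry all the weight, meet only at `h`, and reachability in `ω ∩ (F₁ ∪ F₂)` between `true`-coloured points is
reachability in `ω ∩ F₁`, while a `true` point reaches a `false` point iff it reaches `h` in `ω ∩ F₁` and `h` reaches the target in `ω ∩ F₂`.
This file states these facts ONCE as lemmas (hypotheses `hF₁ : F₁ = …`, `hF₂ : F₂ = …` so that they apply after `set … with hF₁`),
for the gen-16 files `…Row37ThreeOneCutA`, `…Row37ThreeOneCutB`, `…Row15ThreeOneCutB`, ….  No definitions, no named facts, no sorries.
-/

namespace Summit.CriticalPhenomena.PercolationContinuityZ3.Theorems.FrontierDecRows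

open CovTransferCert
open Literature.Probability.Percolation Literature.Probability.LatticeModels

variable {n : ℕ}

/-- The two sides of a cut colouring are edge-disjoint. [this work] -/
theorem cutSides_disjoint (side : Fin n → Bool) (h : Fin n) (F₁ F₂ : Finset (Sym2 (Fin n)))
    (hF₁ : F₁ = Finset.univ.filter (fun e => ∀ u ∈ e, side u = true ∨ u = h))
    (hF₂ : F₂ = Finset.univ.filter (fun e => (∀ u ∈ e, side u = false ∨ u = h) ∧ ¬ ∀ u ∈ e, u = h)) :
    Disjoint F₁ F₂ := by
  rw [Finset.disjoint_left]; intro e h1 h2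
  rw [hF₁, Finset.mem_filter] at h1; rw [hF₂, Finset.mem_filter] at h2
  apply h2.2.2
  intro u hu
  rcases h1.2 u hu with h1 | h1
  · rcases h2.2.1 u hu with h2 | h2
    · rw [h1] at h2; exact absurd h2 (by decide)
    · exact h2
  · exact h1

/-- Under the cut hypothesis every edge outside `F₁ ∪ F₂` has weight zero. [this work] -/
theorem cutSides_weight_zero (w : Sym2 (Fin n) → unitInterval) (side : Fin n → Bool) (h : Fin n) (F₁ F₂ : Finset (Sym2 (Fin n)))
    (hF₁ : F₁ = Finset.univ.filter (fun e => ∀ u ∈ e, side u = true ∨ u = h))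
    (hF₂ : F₂ = Finset.univ.filter (fun e => (∀ u ∈ e, side u = false ∨ u = h) ∧ ¬ ∀ u ∈ e, u = h))
    (hw : ∀ u v : Fin n, u ≠ h → v ≠ h → side u ≠ side v → w s(u, v) = 0) :
    ∀ e, e ∉ F₁ ∪ F₂ → w e = 0 := by
  intro e he
  rw [Finset.mem_union, not_or, hF₁, hF₂, Finset.mem_filter, Finset.mem_filter] at he
  obtain ⟨h1, h2⟩ := he
  simp only [Finset.mem_univ, true_and] at h1 h2
  induction e using Sym2.ind with
  | h u v =>
    have key : u ≠ h ∧ v ≠ h ∧ side u ≠ side v := by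
      by_cases hu : u = h
      · subst hu
        exfalso
        by_cases hv : v = u
        · exact h1 fun x hx => Or.inr (by rcases Sym2.mem_iff.1 hx with e | e <;> [exact e; exact e.trans hv])
        · cases hsv : side v
          · exact h2 ⟨fun x hx => by rcases Sym2.mem_iff.1 hx with e | e <;> [exact Or.inr e; exact Or.inl (e ▸ hsv)],
              fun hall => hv (hall v (Sym2.mem_iff.2 (Or.inr rfl)))⟩
          · exact h1 fun x hx => by rcases Sym2.mem_iff.1 hx with e | e <;> [exact Or.inr e; exact Or.inl (e ▸ hsv)]
      · by_cases hv : v = h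
        · subst hv
          exfalso
          cases hsu : side u
          · exact h2 ⟨fun x hx => by rcases Sym2.mem_iff.1 hx with e | e <;> [exact Or.inl (e ▸ hsu); exact Or.inr e],
              fun hall => hu (hall u (Sym2.mem_iff.2 (Or.inl rfl)))⟩
          · exact h1 fun x hx => by rcases Sym2.mem_iff.1 hx with e | e <;> [exact Or.inl (e ▸ hsu); exact Or.inr e]
        · refine ⟨hu, hv, fun hse => ?_⟩
          cases hsu : side u
          · exact h2 ⟨fun x hx => by
                rcases Sym2.mem_iff.1 hx with e | e <;> [exact Or.inl (e ▸ hsu); exact Or.inl (e ▸ (hse ▸ hsu))],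
              fun hall => hu (hall u (Sym2.mem_iff.2 (Or.inl rfl)))⟩
          · exact h1 fun x hx => by
              rcases Sym2.mem_iff.1 hx with e | e <;> [exact Or.inl (e ▸ hsu); exact Or.inl (e ▸ (hse ▸ hsu))]
    exact hw u v key.1 key.2.1 key.2.2

/-- The two sides meet only at `h`. [this work] -/
theorem cutSides_meet (side : Fin n → Bool) (h : Fin n) (F₁ F₂ : Finset (Sym2 (Fin n)))
    (hF₁ : F₁ = Finset.univ.filter (fun e => ∀ u ∈ e, side u = true ∨ u = h))
    (hF₂ : F₂ = Finset.univ.filter (fun e => (∀ u ∈ e, side u = false ∨ u = h) ∧ ¬ ∀ u ∈ e, u = h))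
    (ω : Set (Sym2 (Fin n))) (v u u' : Fin n) (h1 : (openGraph (ω ∩ ↑F₁)).Adj v u) (h2 : (openGraph (ω ∩ ↑F₂)).Adj v u') :
    v = h := by
  rw [openGraph_adj] at h1 h2
  have m1 := Finset.mem_coe.1 h1.1.2; have m2 := Finset.mem_coe.1 h2.1.2
  rw [hF₁, Finset.mem_filter] at m1; rw [hF₂, Finset.mem_filter] at m2
  rcases m1.2 v (Sym2.mem_iff.2 (Or.inl rfl)) with e1 | e1
  · rcases m2.2.1 v (Sym2.mem_iff.2 (Or.inl rfl)) with e2 | e2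
    · rw [e1] at e2; exact absurd e2 (by decide)
    · exact e2
  · exact e1

/-- A `true`-coloured point other than `h` has no `F₂`-edge. [this work] -/
theorem cutSides_iso₂ (side : Fin n → Bool) (h : Fin n) (F₂ : Finset (Sym2 (Fin n)))
    (hF₂ : F₂ = Finset.univ.filter (fun e => (∀ u ∈ e, side u = false ∨ u = h) ∧ ¬ ∀ u ∈ e, u = h))
    (ω : Set (Sym2 (Fin n))) (x : Fin n) (hx : side x = true) (hxh : x ≠ h) (u : Fin n) : ¬ (openGraph (ω ∩ ↑F₂)).Adj x u := by
  intro hadj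
  rw [openGraph_adj] at hadj
  have m := Finset.mem_coe.1 hadj.1.2
  rw [hF₂, Finset.mem_filter] at m
  rcases m.2.1 x (Sym2.mem_iff.2 (Or.inl rfl)) with e | e
  · rw [hx] at e; exact Bool.noConfusion e
  · exact hxh e

/-- A `false`-coloured point other than `h` has no `F₁`-edge. [this work] -/
theorem cutSides_iso₁ (side : Fin n → Bool) (h : Fin n) (F₁ : Finset (Sym2 (Fin n)))
    (hF₁ : F₁ = Finset.univ.filter (fun e => ∀ u ∈ e, side u = true ∨ u = h))
    (ω : Set (Sym2 (Fin n))) (x : Fin n) (hx : side x = false) (hxh : x ≠ h) (u : Fin n) : ¬ (openGraph (ω ∩ ↑F₁)).Adj x u := by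
  intro hadj
  rw [openGraph_adj] at hadj
  have m := Finset.mem_coe.1 hadj.1.2
  rw [hF₁, Finset.mem_filter] at m
  rcases m.2 x (Sym2.mem_iff.2 (Or.inl rfl)) with e | e
  · rw [hx] at e; exact Bool.noConfusion e
  · exact hxh e

/-- The open graph on `ω ∩ (F₁ ∪ F₂)` is the join of the two side graphs. [this work] -/
theorem cutSides_sup (F₁ F₂ : Finset (Sym2 (Fin n))) (ω : Set (Sym2 (Fin n))) :
    openGraph (ω ∩ ↑(F₁ ∪ F₂)) = openGraph (ω ∩ ↑F₁) ⊔ openGraph (ω ∩ ↑F₂) := by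
  rw [Finset.coe_union, Set.inter_union_distrib_left]
  exact SimpleGraph.fromEdgeSet_union _ _

/-- **Reachability between two `true` points lives on side 1.** [this work] -/
theorem cutSides_reach_left (side : Fin n → Bool) (h : Fin n) (F₁ F₂ : Finset (Sym2 (Fin n)))
    (hF₁ : F₁ = Finset.univ.filter (fun e => ∀ u ∈ e, side u = true ∨ u = h))
    (hF₂ : F₂ = Finset.univ.filter (fun e => (∀ u ∈ e, side u = false ∨ u = h) ∧ ¬ ∀ u ∈ e, u = h))
    (ω : Set (Sym2 (Fin n))) (x z : Fin n) (hx : side x = true) (hz : side z = true) :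
    (openGraph (ω ∩ ↑(F₁ ∪ F₂))).Reachable x z ↔ (openGraph (ω ∩ ↑F₁)).Reachable x z := by
  rw [cutSides_sup]
  exact reachable_sup_iff_left (cutSides_meet side h F₁ F₂ hF₁ hF₂ ω) (cutSides_iso₂ side h F₂ hF₂ ω x hx)
    (cutSides_iso₂ side h F₂ hF₂ ω z hz)

/-- **Reachability from a `true` point to `h` lives on side 1.** [this work] -/
theorem cutSides_reach_h (side : Fin n → Bool) (h : Fin n) (F₁ F₂ : Finset (Sym2 (Fin n)))
    (hF₁ : F₁ = Finset.univ.filter (fun e => ∀ u ∈ e, side u = true ∨ u = h))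
    (hF₂ : F₂ = Finset.univ.filter (fun e => (∀ u ∈ e, side u = false ∨ u = h) ∧ ¬ ∀ u ∈ e, u = h))
    (ω : Set (Sym2 (Fin n))) (x : Fin n) (hx : side x = true) :
    (openGraph (ω ∩ ↑(F₁ ∪ F₂))).Reachable x h ↔ (openGraph (ω ∩ ↑F₁)).Reachable x h := by
  rw [cutSides_sup]
  exact reachable_sup_iff_left (cutSides_meet side h F₁ F₂ hF₁ hF₂ ω) (cutSides_iso₂ side h F₂ hF₂ ω x hx) (fun hh => absurd rfl hh)

/-- **Reachability from a `true` point to a `false` point factors through `h`.** [this work] -/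
theorem cutSides_reach_cross (side : Fin n → Bool) (h : Fin n) (F₁ F₂ : Finset (Sym2 (Fin n)))
    (hF₁ : F₁ = Finset.univ.filter (fun e => ∀ u ∈ e, side u = true ∨ u = h))
    (hF₂ : F₂ = Finset.univ.filter (fun e => (∀ u ∈ e, side u = false ∨ u = h) ∧ ¬ ∀ u ∈ e, u = h))
    (ω : Set (Sym2 (Fin n))) (x t : Fin n) (hx : side x = true) (ht : side t = false) (hxt : x ≠ t) :
    (openGraph (ω ∩ ↑(F₁ ∪ F₂))).Reachable t x ↔
      (openGraph (ω ∩ ↑F₁)).Reachable x h ∧ (openGraph (ω ∩ ↑F₂)).Reachable h t := by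
  rw [SimpleGraph.reachable_comm, cutSides_sup]
  exact reachable_sup_iff_cross (cutSides_meet side h F₁ F₂ hF₁ hF₂ ω) (cutSides_iso₂ side h F₂ hF₂ ω x hx)
    (cutSides_iso₁ side h F₁ hF₁ ω t ht) hxt

end Summit.CriticalPhenomena.PercolationContinuityZ3.Theorems.FrontierDecRows
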